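import Literature.NumberTheory.GaloisCohomology.PoitouTateRestrictedShaExtRoad
import Literature.NumberTheory.GaloisCohomology.RestrictedRamificationExtComparisonBidual
import Literature.NumberTheory.GaloisCohomology.PoitouTateRestrictedRamificationNaturalAt
import Literature.NumberTheory.GaloisCohomology.RestrictedRamificationFiniteCohomologyOfTateEuler
import HarnessLib

/-!
# `poitouTate_shaRestricted_tateDual_natural_at K S` (finite `S`) from an `Ext`-ROAD KIT:
# the class-formation sequence over `C_{G_S}`, its invariant map, Tate duality `α¹`, readouts, and `Ψ(E) = Ш²`

Topic `NumberTheory/GaloisCohomology`; namespace `Literature.NumberTheory.GaloisCohomology.ShaExtRoadKit`.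
One definition WITH BODY (`natS`) and theorems; no named fact, no `sorry`, no instance, no notation.  Lane «PT-Ш-S-TC» of cell `bsd-eis` (crux `GoodLatticeBDPValue`), brick D5c (the
assembly): the named fact `poitouTate_shaRestricted_tateDual_natural_at K S` (bsd-eis LEAD g10, p708774) —
ONE pairing `B n M ρ : Ш²_S(K, M) × Ш¹_S(K, M^D(n)) → ℚ/ℤ` for every module, with (P) finiteness +
perfectness for the admissible ones and (N) naturality for adjoint pairs — DERIVED from a displayed kit of
inputs on Milne's `Ext` road (`PoitouTateRestrictedShaExtRoad`), all module-side glue discharged here: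

* the presented object `A := ⟨(M^D(n))^{N_S}⟩ ∈ C_{G_S}` (written out: `ofContinuousRep
  ((ρ.tateDual n).quotientInvariants N_S)`) and the bridge `natS := (Ext¹(ℤ, A) ≃ H¹(G_S, M^D(n)))⁻¹`
  (`RestrictedRamificationExtTrivComparison`, bijective, natural);
* the comparison `Ext²(A, ⟨Ē_S⟩) → H²(G_S, M)` at Kummer level `#M` and dual level `n`
  (`RestrictedExtCmp.cmp S ρ n (Nat.card M) …`, bijective, natural for adjoint pairs — written out in full at
  every use: wrapper definitions around it exceed the default recursion depth when unfolded);
* `B n M ρ := ShaReadout.pairing` of the `Ext` road if `(n, M)` is admissible (`n ≥ 1`, `n • M = 0`, `M`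
  unramified outside `S`, `v ∣ #M ⇒ v ∈ S`), and `0` otherwise (classical case split);
* (P) = `ShaExtRoad.pairing_perfect` + `finite_restrictedCohomology_one`; (N) = `ShaExtRoad.pairing_natural`
  with `G := quotientInvariantsMap G`, `hcmpG := cmp_natural`, `hnatG := extTrivAddEquiv…_symm_naturality`.

THE KIT (hypotheses of `natural_at_of_kit`, = the lane's other bricks): a short exact
`0 → ⟨Ē_S⟩ →f X₂ →g X₃ → 0` in `C_{G_S}` (`Ē_S = SUnits.sUnitsRestricted K S`; the `S`-idèle / `S`-idèle-class
objects, bsd-eis -w6), `inv : Ext²(ℤ, X₃) → ℚ/ℤ` (bsd-eis -w5, D2-CF), a finite set of places `Sig = S ∪ Ω_∞`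
with perfect local invariant maps and archimedean representability (`harch`, vacuous for `K` totally complex),
and for every admissible `(n, M)`: `α¹(A)` bijective (Tate duality for the `P`-class formation, LEAD's
`tateDuality_finite_of_primary` + engines), readouts `R_v : Ext¹(A, X₂) → H¹(K_v, M)` with (R3)/(R4) (D4b), and
`Ψ(E) = Ш²_S` (`hΨsha`, `hΨsurj`; -w7's `PoitouTateRestrictedShaTwoLocalCriterion` from a local datum `Λ`).

HONEST FRAMING: a reduction with displayed hypotheses; the kit is NOT constructed here, so no case of
Poitou–Tate duality and nothing about BSD is proved by this file.  AI formalisation, weaker than expert review;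
established only by the kernel check.

## References
* J. S. Milne, *Arithmetic Duality Theorems*, 2nd ed. (2006), I Thm. 4.10 (a) (p. 57), its proof (p. 58), §4 p. 65
  ("canonical"). [MilneADT2006]
* D. Harari, *Galois Cohomology and Class Field Theory* (2020), Thm. 17.13 (b), Lemma 17.21, Prop. 17.25, §17.5.
  [Harari2020]
-/

noncomputable section

open CategoryTheory CategoryTheory.Abelian NumberField IsDedekindDomain Function
open scoped NumberField ContRepresentation

namespace Literature.NumberTheory.GaloisCohomology

namespace ShaExtRoadKit

open Literature.Algebra.Homology Literature.Algebra.Homology.DiscreteRep Literature.Algebra.Homology.ExtDuality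
open Literature.NumberTheory.GaloisRepresentations
open Literature.NumberTheory.GaloisRepresentations.DiscreteGaloisModule
open Literature.AnabelianGeometry.AbsoluteAnabelian.Prop121vii (zmodToQmodZ)

variable {K : Type} [Field K] [NumberField K] (S : Set (HeightOneSpectrum (𝓞 K)))
  {M : Type} [AddCommGroup M] [TopologicalSpace M] [DiscreteTopology M] [Finite M]
  (ρ : DiscreteGaloisModule K M) (n : ℕ)

/-! ## §1 The bridge `natS` -/

/-- **The bridge `natS : H¹(G_S, M^D(n)) → Ext¹_{C_{G_S}}(ℤ, A)`** (inverse of the comparison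
`RestrictedExtTriv.extTrivAddEquivRestrictedCohomology`). [cite: Harari2020, §4.3 Remark 4.24] -/
def natS : restrictedCohomology (ρ.tateDual n) S 1 →+
    Ext (triv (Γ := GaloisGroupUnramifiedOutside K S) ℤ) (ofContinuousRep ((ρ.tateDual n).quotientInvariants (ramificationSubgroup K S))) 1 :=
  (RestrictedExtTriv.extTrivAddEquivRestrictedCohomology (ρ.tateDual n) S 1).symm.toAddMonoidHom

/-- `natS` is bijective. [cite: Harari2020, §4.3 Remark 4.24] -/
theorem natS_bijective : Bijective (natS S ρ n) :=
  (RestrictedExtTriv.extTrivAddEquivRestrictedCohomology (ρ.tateDual n) S 1).symm.bijective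

/-! ## §2 The named fact from an `Ext`-road kit -/

set_option maxRecDepth 16384 in
-- (the composed objects `Extʳ(⟨(M^D(n))^{N_S}⟩, ·)`, `Hʳ(G_S, ·^{N_S})`, the comparisons and the skeleton's pairing
-- are deeply nested terms: instantiating the road lemmas at them exceeds the default recursion depth 512)
/-- **`poitouTate_shaRestricted_tateDual_natural_at K S` from an `Ext`-road kit** (finite `S`).  Given the
class-formation short exact sequence `0 → ⟨Ē_S⟩ → X₂ → X₃ → 0` in `C_{G_S}`, its invariant map
`inv : Ext²(ℤ, X₃) → ℚ/ℤ`, a finite set of places `Σ ⊇ Ω_∞` with `Σ_f = S` and perfect local invariant maps,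
archimedean representability, and for every admissible `(n, M)` Tate duality `α¹(⟨(M^D(n))^{N_S}⟩)`, readouts
with (R3)/(R4) and `Ψ(E) = Ш²_S`, the pairing `B n M ρ := ShaReadout.pairing` of the `Ext` road (and `0` for
inadmissible `(n, M)`) satisfies (P) and (N) of the named fact. [cite: MilneADT2006, I Thm. 4.10 (a) (p. 57),
its proof (p. 58) and §4 p. 65] [cite: Harari2020, Thm. 17.13 (b), §17.5] -/
theorem natural_at_of_kit (hSfin : S.Finite)
    {X₂ X₃ : DiscreteRepCat ℤ (GaloisGroupUnramifiedOutside K S)}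
    (f : ofContinuousRep (SUnits.sUnitsRestricted K S) ⟶ X₂) (g : X₂ ⟶ X₃) (w : f ≫ g = 0)
    (hT : (ShortComplex.mk f g w).ShortExact)
    (inv : Ext (triv (Γ := GaloisGroupUnramifiedOutside K S) ℤ) X₃ 2 →+ AddCircle (1 : ℚ))
    (Sig : Finset (Place K)) (hSig₁ : ∀ w : InfinitePlace K, (Sum.inl w : Place K) ∈ Sig)
    (hSig₂ : ∀ v : HeightOneSpectrum (𝓞 K), (Sum.inr v : Place K) ∈ Sig ↔ v ∈ S)
    (linv : ∀ n : ℕ, LocalInvariants K n) (hperf : ∀ (n : ℕ) [NeZero n], (linv n).IsPerfect)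
    (harch : ∀ (n : ℕ) [NeZero n] (M : Type) [AddCommGroup M] [TopologicalSpace M] [DiscreteTopology M]
      [Finite M] (ρ : DiscreteGaloisModule K M) (w : InfinitePlace K)
      (Φ : galoisCohomology ((ρ.tateDual n).toLocal (Sum.inl w)) 1 →+ ZMod n),
      ∃ t : galoisCohomology (ρ.toLocal (Sum.inl w)) 1,
        ∀ x, Φ x = localTatePairingZMod ρ n (Sum.inl w) (linv n (Sum.inl w)) t x)
    (R : ∀ (n : ℕ) (M : Type) [AddCommGroup M] [TopologicalSpace M] [DiscreteTopology M] [Finite M]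
      (ρ : DiscreteGaloisModule K M) (v : Place K), Ext (ofContinuousRep ((ρ.tateDual n).quotientInvariants (ramificationSubgroup K S))) X₂ 1 →+ galoisCohomology (ρ.toLocal v) 1)
    (hα : ∀ (n : ℕ) [NeZero n] (M : Type) [AddCommGroup M] [TopologicalSpace M] [DiscreteTopology M]
      [Finite M] (ρ : DiscreteGaloisModule K M), (∀ m : M, n • m = 0) → GaloisRep.IsUnramifiedOutside S ρ →
      (∀ v : HeightOneSpectrum (𝓞 K), ((Nat.card M : ℕ) : 𝓞 K) ∈ v.asIdeal → v ∈ S) →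
      Bijective (ExtDuality.adjointMap (P := triv (Γ := GaloisGroupUnramifiedOutside K S) ℤ) inv (ofContinuousRep ((ρ.tateDual n).quotientInvariants (ramificationSubgroup K S)))
        (rfl : 1 + 1 = 2)))
    (hR3 : ∀ (n : ℕ) [NeZero n] (M : Type) [AddCommGroup M] [TopologicalSpace M] [DiscreteTopology M]
      [Finite M] (ρ : DiscreteGaloisModule K M), (∀ m : M, n • m = 0) → GaloisRep.IsUnramifiedOutside S ρ →
      (∀ v : HeightOneSpectrum (𝓞 K), ((Nat.card M : ℕ) : 𝓞 K) ∈ v.asIdeal → v ∈ S) →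
      ∀ t : Π v : Place K, galoisCohomology (ρ.toLocal v) 1,
        ∃ e : Ext (ofContinuousRep ((ρ.tateDual n).quotientInvariants (ramificationSubgroup K S))) X₂ 1, ∀ v ∈ Sig, R n M ρ v e = t v)
    (hR4 : ∀ (n : ℕ) [NeZero n] (M : Type) [AddCommGroup M] [TopologicalSpace M] [DiscreteTopology M]
      [Finite M] (ρ : DiscreteGaloisModule K M), (∀ m : M, n • m = 0) → GaloisRep.IsUnramifiedOutside S ρ →
      (∀ v : HeightOneSpectrum (𝓞 K), ((Nat.card M : ℕ) : 𝓞 K) ∈ v.asIdeal → v ∈ S) →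
      ∀ (e : Ext (ofContinuousRep ((ρ.tateDual n).quotientInvariants (ramificationSubgroup K S))) X₂ 1) (y : restrictedCohomology (ρ.tateDual n) S 1),
        ShaExtRoad.read ρ S (T := (ShortComplex.mk f g w)) (ofContinuousRep ((ρ.tateDual n).quotientInvariants (ramificationSubgroup K S))) (triv ℤ) inv (natS S ρ n)
            (ShaExtRoad.idelePart (T := (ShortComplex.mk f g w)) (ofContinuousRep ((ρ.tateDual n).quotientInvariants (ramificationSubgroup K S))) e) y =
          zmodToQmodZ n (∑ v ∈ Sig, localTatePairingZMod ρ n v (linv n v) (R n M ρ v e)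
            (restrictedLocalization (ρ.tateDual n) S v 1 y)))
    (hΨsha : ∀ (n : ℕ) [NeZero n] (M : Type) [AddCommGroup M] [TopologicalSpace M] [DiscreteTopology M]
      [Finite M] [Finite (TateDual K M n)] [NeZero (Nat.card M)] (ρ : DiscreteGaloisModule K M)
      (hn : ∀ m : M, n • m = 0) (hur : GaloisRep.IsUnramifiedOutside S ρ)
      (hS : ∀ v : HeightOneSpectrum (𝓞 K), ((Nat.card M : ℕ) : 𝓞 K) ∈ v.asIdeal → v ∈ S),
      ∀ x : Ext (ofContinuousRep ((ρ.tateDual n).quotientInvariants (ramificationSubgroup K S))) X₃ 1, ShaExtRoad.obstruction ρ S hT (ofContinuousRep ((ρ.tateDual n).quotientInvariants (ramificationSubgroup K S))) (RestrictedExtCmp.cmp S ρ n (Nat.card M) (fun _ => card_nsmul_eq_zero') hS hn ((isUnramifiedOutside_iff_ramificationSubgroup_le_ker ρ S).1 hur) 2) x ∈ shaRestricted ρ S 2)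
    (hΨsurj : ∀ (n : ℕ) [NeZero n] (M : Type) [AddCommGroup M] [TopologicalSpace M] [DiscreteTopology M]
      [Finite M] [Finite (TateDual K M n)] [NeZero (Nat.card M)] (ρ : DiscreteGaloisModule K M)
      (hn : ∀ m : M, n • m = 0) (hur : GaloisRep.IsUnramifiedOutside S ρ)
      (hS : ∀ v : HeightOneSpectrum (𝓞 K), ((Nat.card M : ℕ) : 𝓞 K) ∈ v.asIdeal → v ∈ S),
      ∀ c ∈ shaRestricted ρ S 2, ∃ x : Ext (ofContinuousRep ((ρ.tateDual n).quotientInvariants (ramificationSubgroup K S))) X₃ 1, ShaExtRoad.obstruction ρ S hT (ofContinuousRep ((ρ.tateDual n).quotientInvariants (ramificationSubgroup K S))) (RestrictedExtCmp.cmp S ρ n (Nat.card M) (fun _ => card_nsmul_eq_zero') hS hn ((isUnramifiedOutside_iff_ramificationSubgroup_le_ker ρ S).1 hur) 2) x = c) :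
    poitouTate_shaRestricted_tateDual_natural_at K S := by
  classical
  refine ⟨fun n M _ _ _ _ ρ =>
    if h : NeZero n ∧ (∀ m : M, n • m = 0) ∧ GaloisRep.IsUnramifiedOutside S ρ ∧
        (∀ v : HeightOneSpectrum (𝓞 K), ((Nat.card M : ℕ) : 𝓞 K) ∈ v.asIdeal → v ∈ S) then by
      haveI : NeZero n := h.1
      haveI : Finite (TateDual K M n) := TateDual.finite K M n
      haveI : NeZero (Nat.card M) := ⟨Nat.card_pos.ne'⟩
      have hn := h.2.1
      have hur := h.2.2.1
      have hS := h.2.2.2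
      exact ShaReadout.pairing ρ S Sig (linv n) (ShaExtRoad.idelePart (T := (ShortComplex.mk f g w)) (ofContinuousRep ((ρ.tateDual n).quotientInvariants (ramificationSubgroup K S))))
        (ShaExtRoad.read ρ S (T := (ShortComplex.mk f g w)) (ofContinuousRep ((ρ.tateDual n).quotientInvariants (ramificationSubgroup K S))) (triv ℤ) inv (natS S ρ n))
        (ShaExtRoad.obstruction ρ S hT (ofContinuousRep ((ρ.tateDual n).quotientInvariants (ramificationSubgroup K S))) (RestrictedExtCmp.cmp S ρ n (Nat.card M) (fun _ => card_nsmul_eq_zero') hS hn ((isUnramifiedOutside_iff_ramificationSubgroup_le_ker ρ S).1 hur) 2)) (R n M ρ) hSig₂ (hR4 n M ρ hn hur hS)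
        (ShaExtRoad.exists_idelePart_of_obstruction_eq_zero ρ S hT (ofContinuousRep ((ρ.tateDual n).quotientInvariants (ramificationSubgroup K S))) (RestrictedExtCmp.cmp S ρ n (Nat.card M) (fun _ => card_nsmul_eq_zero') hS hn ((isUnramifiedOutside_iff_ramificationSubgroup_le_ker ρ S).1 hur) 2) (RestrictedExtCmp.cmp_bijective S ρ n (Nat.card M) (fun _ => card_nsmul_eq_zero') hS hn ((isUnramifiedOutside_iff_ramificationSubgroup_le_ker ρ S).1 hur) 2).1)
        (hΨsurj n M ρ hn hur hS)
    else 0, ?_, ?_⟩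
  · -- (P)
    intro n _ M _ _ _ _ ρ hn hur hS
    haveI : Finite (TateDual K M n) := TateDual.finite K M n
    haveI : NeZero (Nat.card M) := ⟨Nat.card_pos.ne'⟩
    haveI : Finite (restrictedCohomology (ρ.tateDual n) S 1) := finite_restrictedCohomology_one hSfin _
    haveI hfin1 : Finite ↥(shaRestricted (ρ.tateDual n) S 1) := inferInstance
    have hcond : NeZero n ∧ (∀ m : M, n • m = 0) ∧ GaloisRep.IsUnramifiedOutside S ρ ∧
        (∀ v : HeightOneSpectrum (𝓞 K), ((Nat.card M : ℕ) : 𝓞 K) ∈ v.asIdeal → v ∈ S) := ⟨‹_›, hn, hur, hS⟩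
    obtain ⟨hfin2, hb1, hb2⟩ := ShaExtRoad.pairing_perfect ρ S hT (ofContinuousRep ((ρ.tateDual n).quotientInvariants (ramificationSubgroup K S))) (triv ℤ) inv (natS S ρ n) (RestrictedExtCmp.cmp S ρ n (Nat.card M) (fun _ => card_nsmul_eq_zero') hS hn ((isUnramifiedOutside_iff_ramificationSubgroup_le_ker ρ S).1 hur) 2)
      Sig (linv n) (R n M ρ) hn hSig₁ hSig₂ (hperf n) (harch n M ρ) (hα n M ρ hn hur hS)
      (natS_bijective S ρ n) (RestrictedExtCmp.cmp_bijective S ρ n (Nat.card M) (fun _ => card_nsmul_eq_zero') hS hn ((isUnramifiedOutside_iff_ramificationSubgroup_le_ker ρ S).1 hur) 2).1 (hR3 n M ρ hn hur hS) (hR4 n M ρ hn hur hS) (hΨsha n M ρ hn hur hS)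
      (hΨsurj n M ρ hn hur hS)
    refine ⟨hfin1, hfin2, ?_, ?_⟩
    · simp only [dif_pos hcond]; exact hb1
    · simp only [dif_pos hcond]; exact hb2
  · -- (N)
    intro n _ M _ _ _ _ ρ n' _ M' _ _ _ _ ρ' hn hur hS hn' hur' hS' F G hFG x x' hx' z' z hz
    haveI : Finite (TateDual K M n) := TateDual.finite K M n
    haveI : NeZero (Nat.card M) := ⟨Nat.card_pos.ne'⟩
    haveI : Finite (TateDual K M' n') := TateDual.finite K M' n'
    haveI : NeZero (Nat.card M') := ⟨Nat.card_pos.ne'⟩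
    have hcond : NeZero n ∧ (∀ m : M, n • m = 0) ∧ GaloisRep.IsUnramifiedOutside S ρ ∧
        (∀ v : HeightOneSpectrum (𝓞 K), ((Nat.card M : ℕ) : 𝓞 K) ∈ v.asIdeal → v ∈ S) := ⟨‹_›, hn, hur, hS⟩
    have hcond' : NeZero n' ∧ (∀ m' : M', n' • m' = 0) ∧ GaloisRep.IsUnramifiedOutside S ρ' ∧
        (∀ v : HeightOneSpectrum (𝓞 K), ((Nat.card M' : ℕ) : 𝓞 K) ∈ v.asIdeal → v ∈ S) := ⟨‹_›, hn', hur', hS'⟩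
    simp only [dif_pos hcond, dif_pos hcond']
    refine ShaExtRoad.pairing_natural ρ S hT (ofContinuousRep ((ρ.tateDual n).quotientInvariants (ramificationSubgroup K S))) (triv ℤ) inv (natS S ρ n) (RestrictedExtCmp.cmp S ρ n (Nat.card M) (fun _ => card_nsmul_eq_zero') hS hn ((isUnramifiedOutside_iff_ramificationSubgroup_le_ker ρ S).1 hur) 2) Sig (linv n) (R n M ρ)
      ρ' (ofContinuousRep ((ρ'.tateDual n').quotientInvariants (ramificationSubgroup K S))) (natS S ρ' n') (RestrictedExtCmp.cmp S ρ' n' (Nat.card M') (fun _ => card_nsmul_eq_zero') hS' hn' ((isUnramifiedOutside_iff_ramificationSubgroup_le_ker ρ' S).1 hur') 2) (linv n') (R n' M' ρ') hSig₂ (RestrictedExtCmp.cmp_bijective S ρ n (Nat.card M) (fun _ => card_nsmul_eq_zero') hS hn ((isUnramifiedOutside_iff_ramificationSubgroup_le_ker ρ S).1 hur) 2).1 (RestrictedExtCmp.cmp_bijective S ρ' n' (Nat.card M') (fun _ => card_nsmul_eq_zero') hS' hn' ((isUnramifiedOutside_iff_ramificationSubgroup_le_ker ρ' S).1 hur') 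2).1
      (hR4 n M ρ hn hur hS) (hΨsurj n M ρ hn hur hS) (hR4 n' M' ρ' hn' hur' hS') (hΨsurj n' M' ρ' hn' hur' hS')
      (RestrictedExtTriv.quotientInvariantsMap (ρ'.tateDual n') (ρ.tateDual n) S G) x x' ?_ z' z ?_
    · -- `hcmpG`: the comparisons intertwine `G^*` with `H²(G_S, F)` (`cmp_natural`), and `x' = F_* x`
      intro x₀ hx₀
      rw [hx', ← hx₀, ShaExtRoad.obstruction_apply,
        ← RestrictedExtCmp.cmp_natural S ρ n (Nat.card M) ρ' n' (Nat.card M') (fun _ => card_nsmul_eq_zero')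
          hS hn ((isUnramifiedOutside_iff_ramificationSubgroup_le_ker ρ S).1 hur) (fun _ => card_nsmul_eq_zero')
          hS' hn' ((isUnramifiedOutside_iff_ramificationSubgroup_le_ker ρ' S).1 hur') F G hFG 2
          (x₀.comp hT.extClass (rfl : 1 + 1 = 2))]
      congr 1
      exact Ext.comp_assoc _ _ _ (zero_add 1) rfl (by omega)
    · -- `hnatG`: `natS` is natural (`extTrivAddEquivRestrictedCohomology_symm_naturality`), and `z = G_* z'`
      rw [hz]
      exact RestrictedExtTriv.extTrivAddEquivRestrictedCohomology_symm_naturality (ρ'.tateDual n') (ρ.tateDual n)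
        S G 1 (z' : restrictedCohomology (ρ'.tateDual n') S 1)

set_option maxRecDepth 16384 in
-- (the composed objects `Extʳ(⟨(M^D(n))^{N_S}⟩, ·)`, `Hʳ(G_S, ·^{N_S})`, the comparisons and the skeleton's pairing
-- are deeply nested terms: instantiating the road lemmas at them exceeds the default recursion depth 512)
set_option maxHeartbeats 400000 in
/-- **`poitouTate_shaRestricted_tateDual_natural_at K S` from an `Ext`-road kit with the bridge `nat` DISPLAYED**
(finite `S`): as `natural_at_of_kit`, but the bridges `nat : H¹(G_S, M^D(n)) → Ext¹(ℤ, A)` are parameters with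
their bijectivity (`hnat`) and naturality (`hnatG`, `G` entering through `RestrictedExtTriv.quotientInvariantsMap`) —
so that a LAYER description of the bridge (bsd-eis -w5 g11's `natLayerS`, on which (R4) is provable) can be plugged in.  Given the
class-formation short exact sequence `0 → ⟨Ē_S⟩ → X₂ → X₃ → 0` in `C_{G_S}`, its invariant map
`inv : Ext²(ℤ, X₃) → ℚ/ℤ`, a finite set of places `Σ ⊇ Ω_∞` with `Σ_f = S` and perfect local invariant maps,
archimedean representability, and for every admissible `(n, M)` Tate duality `α¹(⟨(M^D(n))^{N_S}⟩)`, readouts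
with (R3)/(R4) and `Ψ(E) = Ш²_S`, the pairing `B n M ρ := ShaReadout.pairing` of the `Ext` road (and `0` for
inadmissible `(n, M)`) satisfies (P) and (N) of the named fact. [cite: MilneADT2006, I Thm. 4.10 (a) (p. 57),
its proof (p. 58) and §4 p. 65] [cite: Harari2020, Thm. 17.13 (b), §17.5] -/
theorem natural_at_of_kit' (hSfin : S.Finite)
    {X₂ X₃ : DiscreteRepCat ℤ (GaloisGroupUnramifiedOutside K S)}
    (f : ofContinuousRep (SUnits.sUnitsRestricted K S) ⟶ X₂) (g : X₂ ⟶ X₃) (w : f ≫ g = 0)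
    (hT : (ShortComplex.mk f g w).ShortExact)
    (inv : Ext (triv (Γ := GaloisGroupUnramifiedOutside K S) ℤ) X₃ 2 →+ AddCircle (1 : ℚ))
    (Sig : Finset (Place K)) (hSig₁ : ∀ w : InfinitePlace K, (Sum.inl w : Place K) ∈ Sig)
    (hSig₂ : ∀ v : HeightOneSpectrum (𝓞 K), (Sum.inr v : Place K) ∈ Sig ↔ v ∈ S)
    (linv : ∀ n : ℕ, LocalInvariants K n) (hperf : ∀ (n : ℕ) [NeZero n], (linv n).IsPerfect)
    (harch : ∀ (n : ℕ) [NeZero n] (M : Type) [AddCommGroup M] [TopologicalSpace M] [DiscreteTopology M]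
      [Finite M] (ρ : DiscreteGaloisModule K M) (w : InfinitePlace K)
      (Φ : galoisCohomology ((ρ.tateDual n).toLocal (Sum.inl w)) 1 →+ ZMod n),
      ∃ t : galoisCohomology (ρ.toLocal (Sum.inl w)) 1,
        ∀ x, Φ x = localTatePairingZMod ρ n (Sum.inl w) (linv n (Sum.inl w)) t x)
    (R : ∀ (n : ℕ) (M : Type) [AddCommGroup M] [TopologicalSpace M] [DiscreteTopology M] [Finite M]
      (ρ : DiscreteGaloisModule K M) (v : Place K), Ext (ofContinuousRep ((ρ.tateDual n).quotientInvariants (ramificationSubgroup K S))) X₂ 1 →+ galoisCohomology (ρ.toLocal v) 1)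
    (nat : ∀ (n : ℕ) (M : Type) [AddCommGroup M] [TopologicalSpace M] [DiscreteTopology M] [Finite M]
      (ρ : DiscreteGaloisModule K M),
      restrictedCohomology (ρ.tateDual n) S 1 →+ Ext (triv (Γ := GaloisGroupUnramifiedOutside K S) ℤ) (ofContinuousRep ((ρ.tateDual n).quotientInvariants (ramificationSubgroup K S))) 1)
    (hnat : ∀ (n : ℕ) (M : Type) [AddCommGroup M] [TopologicalSpace M] [DiscreteTopology M] [Finite M]
      (ρ : DiscreteGaloisModule K M), Bijective (nat n M ρ))
    (hnatG : ∀ (n n' : ℕ) (M M' : Type) [AddCommGroup M] [TopologicalSpace M] [DiscreteTopology M] [Finite M]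
      [AddCommGroup M'] [TopologicalSpace M'] [DiscreteTopology M'] [Finite M']
      (ρ : DiscreteGaloisModule K M) (ρ' : DiscreteGaloisModule K M')
      (G : (ρ'.tateDual n').toTopRep ⟶ (ρ.tateDual n).toTopRep) (c : restrictedCohomology (ρ'.tateDual n') S 1),
      nat n M ρ ((ContinuousCohomology.map (ContinuousMonoidHom.id (GaloisGroupUnramifiedOutside K S))
        (ContinuousRep.invariantsHom (N := ramificationSubgroup K S) G) 1).hom c) =
        (nat n' M' ρ' c).comp
          (Ext.mk₀ (RestrictedExtTriv.quotientInvariantsMap (ρ'.tateDual n') (ρ.tateDual n) S G)) (add_zero 1))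
    (hα : ∀ (n : ℕ) [NeZero n] (M : Type) [AddCommGroup M] [TopologicalSpace M] [DiscreteTopology M]
      [Finite M] (ρ : DiscreteGaloisModule K M), (∀ m : M, n • m = 0) → GaloisRep.IsUnramifiedOutside S ρ →
      (∀ v : HeightOneSpectrum (𝓞 K), ((Nat.card M : ℕ) : 𝓞 K) ∈ v.asIdeal → v ∈ S) →
      Bijective (ExtDuality.adjointMap (P := triv (Γ := GaloisGroupUnramifiedOutside K S) ℤ) inv (ofContinuousRep ((ρ.tateDual n).quotientInvariants (ramificationSubgroup K S)))
        (rfl : 1 + 1 = 2)))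
    (hR3 : ∀ (n : ℕ) [NeZero n] (M : Type) [AddCommGroup M] [TopologicalSpace M] [DiscreteTopology M]
      [Finite M] (ρ : DiscreteGaloisModule K M), (∀ m : M, n • m = 0) → GaloisRep.IsUnramifiedOutside S ρ →
      (∀ v : HeightOneSpectrum (𝓞 K), ((Nat.card M : ℕ) : 𝓞 K) ∈ v.asIdeal → v ∈ S) →
      ∀ t : Π v : Place K, galoisCohomology (ρ.toLocal v) 1,
        ∃ e : Ext (ofContinuousRep ((ρ.tateDual n).quotientInvariants (ramificationSubgroup K S))) X₂ 1, ∀ v ∈ Sig, R n M ρ v e = t v)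
    (hR4 : ∀ (n : ℕ) [NeZero n] (M : Type) [AddCommGroup M] [TopologicalSpace M] [DiscreteTopology M]
      [Finite M] (ρ : DiscreteGaloisModule K M), (∀ m : M, n • m = 0) → GaloisRep.IsUnramifiedOutside S ρ →
      (∀ v : HeightOneSpectrum (𝓞 K), ((Nat.card M : ℕ) : 𝓞 K) ∈ v.asIdeal → v ∈ S) →
      ∀ (e : Ext (ofContinuousRep ((ρ.tateDual n).quotientInvariants (ramificationSubgroup K S))) X₂ 1) (y : restrictedCohomology (ρ.tateDual n) S 1),
        ShaExtRoad.read ρ S (T := (ShortComplex.mk f g w)) (ofContinuousRep ((ρ.tateDual n).quotientInvariants (ramificationSubgroup K S))) (triv ℤ) inv (nat n M ρ)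
            (ShaExtRoad.idelePart (T := (ShortComplex.mk f g w)) (ofContinuousRep ((ρ.tateDual n).quotientInvariants (ramificationSubgroup K S))) e) y =
          zmodToQmodZ n (∑ v ∈ Sig, localTatePairingZMod ρ n v (linv n v) (R n M ρ v e)
            (restrictedLocalization (ρ.tateDual n) S v 1 y)))
    (hΨsha : ∀ (n : ℕ) [NeZero n] (M : Type) [AddCommGroup M] [TopologicalSpace M] [DiscreteTopology M]
      [Finite M] [Finite (TateDual K M n)] [NeZero (Nat.card M)] (ρ : DiscreteGaloisModule K M)
      (hn : ∀ m : M, n • m = 0) (hur : GaloisRep.IsUnramifiedOutside S ρ)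
      (hS : ∀ v : HeightOneSpectrum (𝓞 K), ((Nat.card M : ℕ) : 𝓞 K) ∈ v.asIdeal → v ∈ S),
      ∀ x : Ext (ofContinuousRep ((ρ.tateDual n).quotientInvariants (ramificationSubgroup K S))) X₃ 1, ShaExtRoad.obstruction ρ S hT (ofContinuousRep ((ρ.tateDual n).quotientInvariants (ramificationSubgroup K S))) (RestrictedExtCmp.cmp S ρ n (Nat.card M) (fun _ => card_nsmul_eq_zero') hS hn ((isUnramifiedOutside_iff_ramificationSubgroup_le_ker ρ S).1 hur) 2) x ∈ shaRestricted ρ S 2)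
    (hΨsurj : ∀ (n : ℕ) [NeZero n] (M : Type) [AddCommGroup M] [TopologicalSpace M] [DiscreteTopology M]
      [Finite M] [Finite (TateDual K M n)] [NeZero (Nat.card M)] (ρ : DiscreteGaloisModule K M)
      (hn : ∀ m : M, n • m = 0) (hur : GaloisRep.IsUnramifiedOutside S ρ)
      (hS : ∀ v : HeightOneSpectrum (𝓞 K), ((Nat.card M : ℕ) : 𝓞 K) ∈ v.asIdeal → v ∈ S),
      ∀ c ∈ shaRestricted ρ S 2, ∃ x : Ext (ofContinuousRep ((ρ.tateDual n).quotientInvariants (ramificationSubgroup K S))) X₃ 1, ShaExtRoad.obstruction ρ S hT (ofContinuousRep ((ρ.tateDual n).quotientInvariants (ramificationSubgroup K S))) (RestrictedExtCmp.cmp S ρ n (Nat.card M) (fun _ => card_nsmul_eq_zero') hS hn ((isUnramifiedOutside_iff_ramificationSubgroup_le_ker ρ S).1 hur) 2) x = c) :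
    poitouTate_shaRestricted_tateDual_natural_at K S := by
  classical
  refine ⟨fun n M _ _ _ _ ρ =>
    if h : NeZero n ∧ (∀ m : M, n • m = 0) ∧ GaloisRep.IsUnramifiedOutside S ρ ∧
        (∀ v : HeightOneSpectrum (𝓞 K), ((Nat.card M : ℕ) : 𝓞 K) ∈ v.asIdeal → v ∈ S) then by
      haveI : NeZero n := h.1
      haveI : Finite (TateDual K M n) := TateDual.finite K M n
      haveI : NeZero (Nat.card M) := ⟨Nat.card_pos.ne'⟩
      have hn := h.2.1
      have hur := h.2.2.1
      have hS := h.2.2.2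
      exact ShaReadout.pairing ρ S Sig (linv n) (ShaExtRoad.idelePart (T := (ShortComplex.mk f g w)) (ofContinuousRep ((ρ.tateDual n).quotientInvariants (ramificationSubgroup K S))))
        (ShaExtRoad.read ρ S (T := (ShortComplex.mk f g w)) (ofContinuousRep ((ρ.tateDual n).quotientInvariants (ramificationSubgroup K S))) (triv ℤ) inv (nat n M ρ))
        (ShaExtRoad.obstruction ρ S hT (ofContinuousRep ((ρ.tateDual n).quotientInvariants (ramificationSubgroup K S))) (RestrictedExtCmp.cmp S ρ n (Nat.card M) (fun _ => card_nsmul_eq_zero') hS hn ((isUnramifiedOutside_iff_ramificationSubgroup_le_ker ρ S).1 hur) 2)) (R n M ρ) hSig₂ (hR4 n M ρ hn hur hS)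
        (ShaExtRoad.exists_idelePart_of_obstruction_eq_zero ρ S hT (ofContinuousRep ((ρ.tateDual n).quotientInvariants (ramificationSubgroup K S))) (RestrictedExtCmp.cmp S ρ n (Nat.card M) (fun _ => card_nsmul_eq_zero') hS hn ((isUnramifiedOutside_iff_ramificationSubgroup_le_ker ρ S).1 hur) 2) (RestrictedExtCmp.cmp_bijective S ρ n (Nat.card M) (fun _ => card_nsmul_eq_zero') hS hn ((isUnramifiedOutside_iff_ramificationSubgroup_le_ker ρ S).1 hur) 2).1)
        (hΨsurj n M ρ hn hur hS)
    else 0, ?_, ?_⟩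
  · -- (P)
    intro n _ M _ _ _ _ ρ hn hur hS
    haveI : Finite (TateDual K M n) := TateDual.finite K M n
    haveI : NeZero (Nat.card M) := ⟨Nat.card_pos.ne'⟩
    haveI : Finite (restrictedCohomology (ρ.tateDual n) S 1) := finite_restrictedCohomology_one hSfin _
    haveI hfin1 : Finite ↥(shaRestricted (ρ.tateDual n) S 1) := inferInstance
    have hcond : NeZero n ∧ (∀ m : M, n • m = 0) ∧ GaloisRep.IsUnramifiedOutside S ρ ∧
        (∀ v : HeightOneSpectrum (𝓞 K), ((Nat.card M : ℕ) : 𝓞 K) ∈ v.asIdeal → v ∈ S) := ⟨‹_›, hn, hur, hS⟩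
    obtain ⟨hfin2, hb1, hb2⟩ := ShaExtRoad.pairing_perfect ρ S hT (ofContinuousRep ((ρ.tateDual n).quotientInvariants (ramificationSubgroup K S))) (triv ℤ) inv (nat n M ρ) (RestrictedExtCmp.cmp S ρ n (Nat.card M) (fun _ => card_nsmul_eq_zero') hS hn ((isUnramifiedOutside_iff_ramificationSubgroup_le_ker ρ S).1 hur) 2)
      Sig (linv n) (R n M ρ) hn hSig₁ hSig₂ (hperf n) (harch n M ρ) (hα n M ρ hn hur hS)
      (hnat n M ρ) (RestrictedExtCmp.cmp_bijective S ρ n (Nat.card M) (fun _ => card_nsmul_eq_zero') hS hn ((isUnramifiedOutside_iff_ramificationSubgroup_le_ker ρ S).1 hur) 2).1 (hR3 n M ρ hn hur hS) (hR4 n M ρ hn hur hS) (hΨsha n M ρ hn hur hS)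
      (hΨsurj n M ρ hn hur hS)
    refine ⟨hfin1, hfin2, ?_, ?_⟩
    · simp only [dif_pos hcond]; exact hb1
    · simp only [dif_pos hcond]; exact hb2
  · -- (N)
    intro n _ M _ _ _ _ ρ n' _ M' _ _ _ _ ρ' hn hur hS hn' hur' hS' F G hFG x x' hx' z' z hz
    haveI : Finite (TateDual K M n) := TateDual.finite K M n
    haveI : NeZero (Nat.card M) := ⟨Nat.card_pos.ne'⟩
    haveI : Finite (TateDual K M' n') := TateDual.finite K M' n'
    haveI : NeZero (Nat.card M') := ⟨Nat.card_pos.ne'⟩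
    have hcond : NeZero n ∧ (∀ m : M, n • m = 0) ∧ GaloisRep.IsUnramifiedOutside S ρ ∧
        (∀ v : HeightOneSpectrum (𝓞 K), ((Nat.card M : ℕ) : 𝓞 K) ∈ v.asIdeal → v ∈ S) := ⟨‹_›, hn, hur, hS⟩
    have hcond' : NeZero n' ∧ (∀ m' : M', n' • m' = 0) ∧ GaloisRep.IsUnramifiedOutside S ρ' ∧
        (∀ v : HeightOneSpectrum (𝓞 K), ((Nat.card M' : ℕ) : 𝓞 K) ∈ v.asIdeal → v ∈ S) := ⟨‹_›, hn', hur', hS'⟩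
    simp only [dif_pos hcond, dif_pos hcond']
    refine ShaExtRoad.pairing_natural ρ S hT (ofContinuousRep ((ρ.tateDual n).quotientInvariants (ramificationSubgroup K S))) (triv ℤ) inv (nat n M ρ) (RestrictedExtCmp.cmp S ρ n (Nat.card M) (fun _ => card_nsmul_eq_zero') hS hn ((isUnramifiedOutside_iff_ramificationSubgroup_le_ker ρ S).1 hur) 2) Sig (linv n) (R n M ρ)
      ρ' (ofContinuousRep ((ρ'.tateDual n').quotientInvariants (ramificationSubgroup K S))) (nat n' M' ρ') (RestrictedExtCmp.cmp S ρ' n' (Nat.card M') (fun _ => card_nsmul_eq_zero') hS' hn' ((isUnramifiedOutside_iff_ramificationSubgroup_le_ker ρ' S).1 hur') 2) (linv n') (R n' M' ρ') hSig₂ (RestrictedExtCmp.cmp_bijective S ρ n (Nat.card M) (fun _ => card_nsmul_eq_zero') hS hn ((isUnramifiedOutside_iff_ramificationSubgroup_le_ker ρ S).1 hur) 2).1 (RestrictedExtCmp.cmp_bijective S ρ' n' (Nat.card M') (fun _ => card_nsmul_eq_zero') hS' hn' ((isUnramifiedOutside_iff_ramificationSubgroup_le_ker ρ' S).1 hur')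 2).1
      (hR4 n M ρ hn hur hS) (hΨsurj n M ρ hn hur hS) (hR4 n' M' ρ' hn' hur' hS') (hΨsurj n' M' ρ' hn' hur' hS')
      (RestrictedExtTriv.quotientInvariantsMap (ρ'.tateDual n') (ρ.tateDual n) S G) x x' ?_ z' z ?_
    · -- `hcmpG`: the comparisons intertwine `G^*` with `H²(G_S, F)` (`cmp_natural`), and `x' = F_* x`
      intro x₀ hx₀
      rw [hx', ← hx₀, ShaExtRoad.obstruction_apply,
        ← RestrictedExtCmp.cmp_natural S ρ n (Nat.card M) ρ' n' (Nat.card M') (fun _ => card_nsmul_eq_zero')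
          hS hn ((isUnramifiedOutside_iff_ramificationSubgroup_le_ker ρ S).1 hur) (fun _ => card_nsmul_eq_zero')
          hS' hn' ((isUnramifiedOutside_iff_ramificationSubgroup_le_ker ρ' S).1 hur') F G hFG 2
          (x₀.comp hT.extClass (rfl : 1 + 1 = 2))]
      congr 1
      exact Ext.comp_assoc _ _ _ (zero_add 1) rfl (by omega)
    · -- `hnatG`: `natS` is natural (`extTrivAddEquivRestrictedCohomology_symm_naturality`), and `z = G_* z'`
      rw [hz]
      exact hnatG n n' M M' ρ ρ' G (z' : restrictedCohomology (ρ'.tateDual n') S 1)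

/-! ## §3 Booking the support of `A = ⟨(M^D(n))^{N_S}⟩` (for the kit's `hα` from Tate duality for `(G_S, C̄_S)`) -/

/-- **The admissibility of `M` passes to `A = ⟨(M^D(n))^{N_S}⟩`**: if `n • M = 0` and every `v` with
`(#M) ∈ v` lies in `S`, then every `v` with `(#A) ∈ v` lies in `S` — since `#A ∣ #M^D(n) = #M`
(Lagrange + `|Hom(M, μₙ)| = |M|`).  This is the hypothesis under which bsd-eis -w8 g13's
`IdeleClassBar.adjointMap_one_bijective_classBarSD A` delivers the kit's `hα`.
[cite: MilneADT2006, I Thm. 4.10 (a) (p. 57: "S contains all primes dividing the order of M")] -/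
theorem forall_natCard_obj_mem_of_natCard_mem [NeZero n]
    (hn : ∀ m : M, n • m = 0)
    (hS : ∀ v : HeightOneSpectrum (𝓞 K), ((Nat.card M : ℕ) : 𝓞 K) ∈ v.asIdeal → v ∈ S)
    (v : HeightOneSpectrum (𝓞 K))
    (hv : ((Nat.card ((ρ.tateDual n).invariantsOf (ramificationSubgroup K S)) : ℕ) : 𝓞 K) ∈ v.asIdeal) :
    v ∈ S := by
  -- `#A ∣ #M^D(n)` (Lagrange) and `#M^D(n) = #M`
  have h1 : Nat.card ((ρ.tateDual n).invariantsOf (ramificationSubgroup K S)) ∣ Nat.card (TateDual K M n) :=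
    AddSubgroup.card_addSubgroup_dvd_card
      ((ρ.tateDual n).invariantsOf (ramificationSubgroup K S)).toAddSubgroup
  have h2 : Nat.card (TateDual K M n) = Nat.card M := HomCarrier.natCard_eq (muEquivZMod K n) hn
  obtain ⟨k, hk⟩ := h1
  refine hS v ?_
  rw [← h2, hk, Nat.cast_mul]
  exact v.asIdeal.mul_mem_right _ hv

end ShaExtRoadKit

end Literature.NumberTheory.GaloisCohomology

end
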